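import Mathlib
import Summits.NavierStokesRegularity.NavierStokesRegularity.Theses.SlicedKelvin

/-!
# Crux `SlicedKelvin.FluxZoom` (stmt-NavierStokesRegularity-15603), line `registered`,
# stub `stub_sliceFDerivContinuous`: time-continuity of the spatial gradient of the slices of a
# jointly smooth space-time field

Support file (theorems only, `--supports stmt-NavierStokesRegularity-15603`) for the lead's
skeleton of the crux `FluxZoom` of route `SlicedKelvin`. If `V : ℝ → ℝ³ → ℝ³` is jointly `C^∞`
on the open slab `Ioo a b ×ˢ univ`, then for every `x` the spatial derivative of the time slices,
`t ↦ D(V t)(x)`, is continuous on `Ioo a b`. In the crux this passes a time-Lipschitz bound for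
the rescaled (classical) blow-up solutions to the endpoint of the time interval.

## Proof

Pure calculus. The slab `S := Ioo a b ×ˢ univ` is open, so the joint derivative
`D(uncurry V)` is continuous on `S` (`ContDiffOn.continuousOn_fderiv_of_isOpen`). For `t ∈ Ioo a b`
the slice `V t` is `uncurry V ∘ (t, ·)`, so by the chain rule
`D(V t)(x) = D(uncurry V)(t, x) ∘ inr` (`hasFDerivAt_prodMk_right`, `HasFDerivAt.comp`), and
`t ↦ D(uncurry V)(t, x) ∘ inr` is continuous on `Ioo a b` as the composition of a continuous map
into `S` with `D(uncurry V)`, post-composed with the fixed continuous linear map `inr`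
(`ContinuousOn.clm_comp`).

No named fact is assumed: every ingredient is a theorem of Mathlib.
-/

noncomputable section

-- the summit and its single sub-problem share the name (CONVENTIONS §1), as in every Theorems file
set_option linter.dupNamespace false

open Set Topology

namespace Summit.NavierStokesRegularity.NavierStokesRegularity.Theorems.FluxZoom.Registered

/-- **Chain rule for a time slice.** If `uncurry V` is differentiable at `(t, x)`, then the slice
`V t` has derivative `D(uncurry V)(t, x) ∘ inr` at `x`. -/
theorem hasFDerivAt_slice {E F G : Type*} [NormedAddCommGroup E] [NormedSpace ℝ E]
    [NormedAddCommGroup F] [NormedSpace ℝ F] [NormedAddCommGroup G] [NormedSpace ℝ G]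
    {V : E → F → G} {t : E} {x : F}
    (h : DifferentiableAt ℝ (Function.uncurry V) (t, x)) :
    HasFDerivAt (V t)
      ((fderiv ℝ (Function.uncurry V) (t, x)).comp (ContinuousLinearMap.inr ℝ E F)) x := by
  have hc : HasFDerivAt (Function.uncurry V ∘ fun y : F => (t, y))
      ((fderiv ℝ (Function.uncurry V) (t, x)).comp (ContinuousLinearMap.inr ℝ E F)) x :=
    h.hasFDerivAt.comp x (hasFDerivAt_prodMk_right t x)
  exact hc

/-- **Time-continuity of the spatial gradient of the slices.** If `V : ℝ → ℝ³ → ℝ³` is jointly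
`C^∞` on the open slab `Ioo a b ×ˢ univ`, then for every `x` the map `t ↦ D(V t)(x)` is
continuous on `Ioo a b`. -/
theorem stub_sliceFDerivContinuous :
    ∀ (V : ℝ → EuclideanSpace ℝ (Fin 3) → EuclideanSpace ℝ (Fin 3)) (a b : ℝ),
      ContDiffOn ℝ (⊤ : ℕ∞) (Function.uncurry V) (Set.Ioo a b ×ˢ Set.univ) →
      ∀ x, ContinuousOn (fun t => fderiv ℝ (V t) x) (Set.Ioo a b) := by
  intro V a b hV x
  have hS : IsOpen (Set.Ioo a b ×ˢ (Set.univ : Set (EuclideanSpace ℝ (Fin 3)))) :=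
    isOpen_Ioo.prod isOpen_univ
  -- the joint derivative is continuous on the open slab
  have hD : ContinuousOn (fderiv ℝ (Function.uncurry V)) (Set.Ioo a b ×ˢ Set.univ) :=
    hV.continuousOn_fderiv_of_isOpen hS (by simp)
  -- `t ↦ (t, x)` maps `Ioo a b` continuously into the slab
  have hι : ContinuousOn (fun t : ℝ => (t, x)) (Set.Ioo a b) :=
    (continuous_id.prodMk continuous_const).continuousOn
  have hmaps : MapsTo (fun t : ℝ => (t, x)) (Set.Ioo a b) (Set.Ioo a b ×ˢ Set.univ) :=
    fun t ht => ⟨ht, mem_univ x⟩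
  have hDι : ContinuousOn (fun t : ℝ => fderiv ℝ (Function.uncurry V) (t, x)) (Set.Ioo a b) :=
    hD.comp hι hmaps
  -- post-compose with the fixed continuous linear map `inr`
  have hcomp : ContinuousOn (fun t : ℝ => (fderiv ℝ (Function.uncurry V) (t, x)).comp
      (ContinuousLinearMap.inr ℝ ℝ (EuclideanSpace ℝ (Fin 3)))) (Set.Ioo a b) :=
    hDι.clm_comp continuousOn_const
  -- on `Ioo a b` the slice derivative is given by the chain rule
  refine hcomp.congr fun t ht => ?_
  have hdiff : DifferentiableAt ℝ (Function.uncurry V) (t, x) :=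
    (hV.contDiffAt (hS.mem_nhds ⟨ht, mem_univ x⟩)).differentiableAt (by simp)
  exact (hasFDerivAt_slice hdiff).fderiv

end Summit.NavierStokesRegularity.NavierStokesRegularity.Theorems.FluxZoom.Registered

end
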